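import Summits.HodgeConjecture.FermatCycles.HodgeFermatBridge
import Summits.HodgeConjecture.FermatCycles.HodgeFermatTheoremZ3UA

/-!
# PROPOSITION L7(a) at the levels prime to 3 — part 1: the pointwise lemma (`HodgeFermat/PropL7a.lean`; HF-G21f)

Tree copy (part 1 of 2) of the module `HodgeFermat/PropL7a.lean` of the sibling cell's standalone package
`run/shared/lean/pub/pub-hodgefermat/lean/HodgeFermat/` (499 lines, sha256 `9b148baeb65a0a99…`), source lines 30–236 (§§1–2: the carry lemmas at 7 off 3, `rsum_const_of_dvd`, the pointwise lemma `UZ1_seven_pointwise`).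
Filed by cell `pub-hfermat`, seat prover-1 gen-3, on the COORDINATOR KEEPER RULING of 2026-08-25 (gem sweep H1: take the
off-gate kernel theorem `thmFstar` through the gate) — here THEOREM F* of `tables/DPRIME-THEOREM.md` §9 IN FULL, i.e.
PROPOSITION D′(3N) and the descent (`HodgeFermat/PropDPrimeNFinal.lean`, GATE HF-G34), the last off-gate form of THEOREM F*
(its first two forms, `DecodingFinal.thmFstar` = F* at the prime levels and `ThmFstarNFinal.thmFstar` = F*(3N), landed on
2026-08-25 as `HodgeFermatThmFstar.lean` / `HodgeFermatThmFstarN.lean`, seats prover-1 gen-0 / gen-2); this file is one link of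
the import closure of `PropDPrimeNFinal.propDprime` (the sibling's KR-free chain: THEOREM L, COROLLARY M, THEOREM D6,
THEOREM U⁺, THEOREM KR6, THEOREM Z3U) on top of those landed chains.  The source module is the sibling's hub-checked module of
record (pub-hodgefermat `CERT.md` l.879, GATE HF-G21f; cell record `check/PropL7a_standalone.lean` sha256 `b35a6b56b24ad008…`); its declarations are copied VERBATIM.
Deviations from the source module, exhaustively: the `import` lines (tree modules `Summits.HodgeConjecture.FermatCycles.
HodgeFermat*` instead of `HodgeFermat.*`); this module docstring; the two re-binding lines of `HodgeFermatBridge.lean` (`open HodgeFermat.KRFree.Decoding renaming st_symm → sameType_symm, st_trans → sameType_trans, st_swap → sameType_swap, st_rot → sameType_rot, unit_mul_not_dvd → not_dvd_unit_mul`, `open HodgeFermat.KRFree.Decoding (rsum_swap rsum_rot)`) are added because this module used those deleted `Bridge` copies through `open … Bridge`; DEDUP (pre-empting the gate's `dedup.landed`): the source's `lemma rsum_const_of_dvd` (l.105–130) is VERBATIM (up to names) `HodgeFermat.KRFree.TheoremZ3U.rsum_const₃` of `HodgeFermatTheoremZ3UA.lean` and is DELETED, re-bound by `open HodgeFermat.KRFree.TheoremZ3U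 renaming not_dvd_cofactor' → not_dvd_cofactor, rsum_const₃ → rsum_const_of_dvd` (extra import); the file ends at source l.236 with an `end` line (part 2 = `HodgeFermatPropL7aB.lean`).
Every other line — in particular every declaration's statement and proof — is byte-identical to the source.
HONEST FRAMING: explicit algebraic cycles for specific Hodge classes on Fermat/Delsarte varieties; residual open instances
listed; no claim on general Hodge.  (This file is arithmetic of CM types / finite combinatorics / analytic number theory
of the sibling's KR-free programme; it claims nothing about cycles.)

The source module's docstring (PropL7a.lean l.1–27), verbatim:

HodgeFermat/PropL7a.lean — generation 21 (fourth addendum) of the hodge-fermat build.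

PROPOSITION L7(a) of `tables/DPRIME-THEOREM.md` §3 at the levels prime to 3 — exactly the form in which the proof
of THEOREM D6 (`tables/KR-FREE.md` §7) uses it: at an odd squarefree level `m = 7n` (`7 ∤ n`, `3 ∤ n`) a
jointly primitive pair {T of class U, T' of class Z1 at 7} is never a coincidence.

Proof formalised (the hand proof of DPRIME §3, (U,Z1) row "p = 7" + DESCENT LEMMA + PROP. L7(a), case n' = 5):
* §1  the (U,Z1) row bound at `p = 7` (`row_UZ1`: `7n ≤ 14g + 5n`, `g = gcd(y,n)`) with `n/g` odd, `≠ 3, 7`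
      forces `n = 5g` (`five_g_of_bound7`);
* §2  POINTWISE ANALYSIS at `p = 7`, `n = 5g`: the values `⟨ty⟩_n = g·s(t)`, `s ∈ {1,2,3,4}`, the chain rule
      `s(7⁻¹t) ≡ 3 s(t) (mod 5)` (`val_step7`), and the fibre identity (E) of LEMMA N (`fibre_identity_Z1U`,
      here `step7`) give, writing `B(t)` for the carry sum of `T̄' = T' mod n`:  `s(t) = 1 ⇒ B(7⁻¹t) = B(t) + n`,
      `s(t) = 4 ⇒ B(t) = B(7⁻¹t) + n`; hence `T̄'` has no zero entry and `B(t) = n ⟺ s(t) ∈ {1,2} ⟺ t ∈ H_V`,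
      `V = (y, y, 3y)`: **`T̄'` has the CM type of `V = g·(z', z', 3z')` at level `n`** (`UZ1_seven_pointwise`);
* §3  DESCENT: `sameType_descend` (divide level and entries by a common factor), `z3_vs_any` (rows (Z3,U),
      (Z3,Z1) of THEOREM L after a permutation: a Z3-at-`q` triple never shares its type with a non-Z3 one,
      `q ≥ 7`); with `G = gcd(n, T̄', y)`: at level `n/G` the pair {T̄'/G, V/G} is jointly primitive, `V/G` is
      Z3 at every prime of `g/G` (all `≥ 11`) ⇒ `g = G`, i.e. `g ∣ T'`; then at level `m = 7n` the pair {T', T}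
      is (Z3 at q, not Z3 at q) for every prime `q ∣ g` ⇒ `g = 1`, `n = 5`, `m = 35`;
* §4  `m = 35`: the kernel fact `F35` of `KRFreeFacts.lean` through the bridge `coincidenceFree_first`
      (`Bridge.lean`) makes `T ≡ T'` up to order mod 35 — impossible as `7 ∣ 7y` but `7 ∤ x', y', z'`.
Main theorem: `row_UZ1_seven_not3`.  (At `3 ∣ n` PROP. L7(a) has the second case `n' = 3`, `V ∼ (z', z', z')`,
which needs F33/F165-type facts not in this package; not formalised here.)

No `sorry`; no `native_decide`; `autoImplicit false`.  Lean 4 v4.32.0 / Mathlib v4.32.0.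
-/

set_option autoImplicit false

namespace HodgeFermat.KRFree.TheoremL

open HodgeFermat.KRFree HodgeFermat.KRFree.LemmaN HodgeFermat.KRFree.LemmaO HodgeFermat.KRFree.Bridge

open HodgeFermat.KRFree.Decoding renaming st_symm → sameType_symm, st_trans → sameType_trans, st_swap → sameType_swap, st_rot → sameType_rot, unit_mul_not_dvd → not_dvd_unit_mul
open HodgeFermat.KRFree.Decoding (rsum_swap rsum_rot)
open HodgeFermat.KRFree.TheoremZ3U renaming not_dvd_cofactor' → not_dvd_cofactor, rsum_const₃ → rsum_const_of_dvd

/-! ## §1  `n = 5·gcd(y,n)` at `p = 7`, `3 ∤ n` -/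

/-- from the (U,Z1) bound at `p = 7` (`7n ≤ 14g + 5n`, i.e. `n/g ≤ 7`) with `n/g` odd, `≥ 2`, `≠ 3`, `≠ 7` -/
lemma five_g_of_bound7 (n y : ℕ) (hn : 0 < n) (hodd : Odd n) (h7n : ¬ 7 ∣ n) (h3 : ¬ 3 ∣ n) (hy : ¬ n ∣ y)
    (h : 7 * n ≤ 2 * (7 * Nat.gcd y n) + 5 * n) : n = 5 * Nat.gcd y n := by
  obtain ⟨n', z', hn'0, hn', _, _, hdn⟩ := decompose n y hn
  have h2 := two_le_quot n y hn hy
  have ho := quot_odd n y hn hodd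
  rw [hdn] at h2 ho
  have hg0 : 0 < Nat.gcd y n := Nat.gcd_pos_of_pos_right _ hn
  obtain ⟨g, hg⟩ : ∃ g, Nat.gcd y n = g := ⟨_, rfl⟩
  rw [hg] at h hn' hg0 ⊢
  rw [hn'] at h
  have h' : g * (7 * n') ≤ g * (14 + 5 * n') := by
    calc g * (7 * n') = 7 * (g * n') := by ring
      _ ≤ 2 * (7 * g) + 5 * (g * n') := h
      _ = g * (14 + 5 * n') := by ring
  have hq : 7 * n' ≤ 14 + 5 * n' := Nat.le_of_mul_le_mul_left h' hg0
  have h3' : n' ≠ 3 := by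
    rintro rfl; exact h3 ⟨g, by rw [hn']; ring⟩
  have h7' : n' ≠ 7 := by
    rintro rfl; exact h7n ⟨g, by rw [hn']; ring⟩
  obtain ⟨k, hk⟩ := ho
  have : n' = 5 := by omega
  rw [hn', this]; ring

/-! ## §2  Pointwise analysis at `p = 7`, `n = 5g` -/

/-- the value `⟨ty⟩_n = g·s` with `s ∈ {1,2,3,4}` (LEMMA O) -/
lemma val_cases5 (n g y t : ℕ) (hn : 0 < n) (hg : Nat.gcd y n = g) (hn5 : n = 5 * g)
    (ht : Nat.Coprime t n) : ∃ s, 1 ≤ s ∧ s ≤ 4 ∧ t * y % n = g * s := by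
  obtain ⟨s, hs5, hsc, hv⟩ := lemmaO_mem n y t hn ht
  have hg0 : 0 < g := by rw [← hg]; exact Nat.gcd_pos_of_pos_right _ hn
  rw [hg] at hs5 hsc hv
  have hq : n / g = 5 := Nat.div_eq_of_eq_mul_right hg0 (by omega)
  rw [hq] at hs5 hsc
  refine ⟨s, ?_, by omega, hv⟩
  rcases Nat.eq_zero_or_pos s with h0 | h0
  · subst h0; simp at hsc
  · exact h0

/-- the chain rule: `7 t₁ ≡ t₀ (mod n)`, `⟨t₁y⟩ = g s₁`, `⟨t₀y⟩ = g s₀` ⇒ `s₀ = 7 s₁ mod 5 (= 2 s₁ mod 5)` -/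
lemma val_step7 (n g y t₀ t₁ s₀ s₁ : ℕ) (hn5 : n = 5 * g) (hg : 0 < g) (h : 7 * t₁ ≡ t₀ [MOD n])
    (hs₁ : t₁ * y % n = g * s₁) (hs₀ : t₀ * y % n = g * s₀) : s₀ = 7 * s₁ % 5 := by
  have h1 : (7 * t₁ * y) % n = t₀ * y % n := Nat.ModEq.mul_right y h
  have h2 : (7 * t₁ * y) % n = g * (7 * s₁ % 5) := by
    rw [mul_assoc, ← Nat.mul_mod_mod, hs₁, show 7 * (g * s₁) = g * (7 * s₁) by ring, hn5,
      show 5 * g = g * 5 by ring, Nat.mul_mod_mul_left]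
  rw [h1, hs₀] at h2
  exact Nat.eq_of_mul_eq_mul_left hg h2

/-- the fibre identity (E) of LEMMA N at `p = 7`, `n = 5g`, at a unit `t₀` with `7t₁ ≡ t₀`, `⟨t₀y⟩ = g s₀`:
`2n·⌊7s₀/5⌋ + 2c(t₀)n + 2c'(t₁)n + n = 7n + 2c(t₁)n + 2c'(t₀)n` (carries as `rsum`) -/
lemma step7 (n g y x₂ x₃ x' y' z' t₀ t₁ s₀ : ℕ) (hn5 : n = 5 * g) (hg : 0 < g) (h7n : ¬ 7 ∣ n) (hn : 0 < n)
    (hs : 7 * n ∣ 7 * y + x₂ + x₃) (hx₂ : ¬ 7 ∣ x₂) (hx₃ : ¬ 7 ∣ x₃)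
    (hs' : 7 * n ∣ x' + y' + z') (hx' : ¬ 7 ∣ x') (hy' : ¬ 7 ∣ y') (hz' : ¬ 7 ∣ z')
    (ht₀ : Nat.Coprime t₀ n) (ht₁ : 7 * t₁ ≡ t₀ [MOD n]) (hv : t₀ * y % n = g * s₀)
    (hH : SameType (7 * n) (7 * y, x₂, x₃) (x', y', z')) :
    2 * n * (7 * s₀ / 5) + 2 * rsum n (7 * y, x₂, x₃) t₀ + 2 * rsum n (x', y', z') t₁ + n
      = 7 * n + 2 * rsum n (7 * y, x₂, x₃) t₁ + 2 * rsum n (x', y', z') t₀ := by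
  have hp : (7).Prime := by norm_num
  have hE := fibre_identity_Z1U 7 n y x₂ x₃ x' y' z' t₀ t₁ hp h7n hn hs hx₂ hx₃ hs' hx' hy' hz' ht₀ ht₁ hH
  rw [hv] at hE
  have hk : 7 * (g * s₀) / n = 7 * s₀ / 5 := by
    rw [hn5, show 7 * (g * s₀) = g * (7 * s₀) by ring, show 5 * g = g * 5 by ring]
    exact Nat.mul_div_mul_left (7 * s₀) 5 hg
  rw [hk] at hE
  exact hE


/-- POINTWISE ANALYSIS at `p = 7`, `3 ∤ n`: a (U,Z1) coincidence `{T = (7y, x₂, x₃), T' = (x', y', z')}` at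
level `7n` forces `n = 5g` (`g = gcd(y,n)`), `T̄' = T' mod n` without zero entry, and `T̄' ∼ V = (y, y, 3y)` at
level `n` -/
theorem UZ1_seven_pointwise (n y x₂ x₃ x' y' z' : ℕ) (h7n : ¬ 7 ∣ n) (hn : 0 < n) (hodd : Odd n)
    (h3 : ¬ 3 ∣ n) (hs : 7 * n ∣ 7 * y + x₂ + x₃) (hx₂ : ¬ 7 ∣ x₂) (hx₃ : ¬ 7 ∣ x₃)
    (hs' : 7 * n ∣ x' + y' + z') (hx' : ¬ 7 ∣ x') (hy' : ¬ 7 ∣ y') (hz' : ¬ 7 ∣ z') (hy : ¬ n ∣ y)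
    (hH : SameType (7 * n) (7 * y, x₂, x₃) (x', y', z')) :
    n = 5 * Nat.gcd y n ∧ ¬ n ∣ x' ∧ ¬ n ∣ y' ∧ ¬ n ∣ z' ∧ SameType n (x', y', z') (y, y, 3 * y) := by
  have hp : (7).Prime := by norm_num
  have h7cop : Nat.Coprime 7 n := (Nat.Prime.coprime_iff_not_dvd hp).mpr h7n
  have hb := row_UZ1 7 n y x₂ x₃ x' y' z' hp h7n hn hs hx₂ hx₃ hs' hx' hy' hz' hy hH
  have hn5 := five_g_of_bound7 n y hn hodd h7n h3 hy hb
  obtain ⟨g, hg⟩ : ∃ g, Nat.gcd y n = g := ⟨_, rfl⟩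
  have hg0 : 0 < g := by rw [← hg]; exact Nat.gcd_pos_of_pos_right _ hn
  refine ⟨hn5, ?_⟩
  rw [hg] at hn5
  have hsn' : n ∣ x' + y' + z' := dvd_of_level hs'
  have hsn : n ∣ 7 * y + x₂ + x₃ := dvd_of_level hs
  have hval : ∀ t, Nat.Coprime t n → ∃ s, 1 ≤ s ∧ s ≤ 4 ∧ t * y % n = g * s :=
    fun t ht => val_cases5 n g y t hn hg hn5 ht
  -- the two consequences of (E): s(u) = 1 ⇒ B(t₁) = B(u) + n;  s(u) = 4 ⇒ B(u) = B(t₁) + n  (7t₁ ≡ u)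
  have key : ∀ u t₁ s₀, Nat.Coprime u n → 7 * t₁ ≡ u [MOD n] → u * y % n = g * s₀ →
      (s₀ = 1 → rsum n (x', y', z') t₁ = rsum n (x', y', z') u + n) ∧
      (s₀ = 4 → rsum n (x', y', z') u = rsum n (x', y', z') t₁ + n) := by
    intro u t₁ s₀ hu ht₁ hv
    have hu₁ := coprime_t₁ ht₁ hu
    have hE := step7 n g y x₂ x₃ x' y' z' u t₁ s₀ hn5 hg0 h7n hn hs hx₂ hx₃ hs' hx' hy' hz' hu ht₁ hv hH
    have hdA := delta_le n (7 * y) x₂ x₃ u t₁ hn hsn hu hu₁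
    have hdB := delta_le n x' y' z' u t₁ hn hsn' hu hu₁
    obtain ⟨A₀, hA0⟩ : ∃ R, rsum n (7 * y, x₂, x₃) u = R := ⟨_, rfl⟩
    obtain ⟨A₁, hA1⟩ : ∃ R, rsum n (7 * y, x₂, x₃) t₁ = R := ⟨_, rfl⟩
    obtain ⟨B₀, hB0⟩ : ∃ R, rsum n (x', y', z') u = R := ⟨_, rfl⟩
    obtain ⟨B₁, hB1⟩ : ∃ R, rsum n (x', y', z') t₁ = R := ⟨_, rfl⟩
    rw [hA0, hA1, hB0, hB1] at hE
    rw [hA0, hA1] at hdA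
    rw [hB0, hB1] at hdB
    rw [hB0, hB1]
    constructor
    · intro h1; rw [h1] at hE; omega
    · intro h4; rw [h4] at hE; omega
  -- a unit of value g, its 7⁻¹-translate, and the consequence B(w₁) = B(u₁) + n
  obtain ⟨u₁, hu₁, hv₁⟩ := lemmaO_g n y hn hy
  rw [hg] at hv₁
  have hv₁' : u₁ * y % n = g * 1 := by rw [mul_one]; exact hv₁
  obtain ⟨w₁, hw₁⟩ := exists_t₁ 7 n u₁ hp h7n hn
  have hw₁u := coprime_t₁ hw₁ hu₁
  have hK := (key u₁ w₁ 1 hu₁ hw₁ hv₁').1 rfl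
  -- no entry of T' is ≡ 0 (mod n)
  have hz'n : ¬ n ∣ z' := by
    intro hd
    have hc := rsum_const_of_dvd hn hsn' hd hw₁u hu₁
    omega
  have hx'n : ¬ n ∣ x' := by
    intro hd
    have hs2 : n ∣ y' + z' + x' := by rwa [show y' + z' + x' = x' + y' + z' by ring]
    have hc := rsum_const_of_dvd hn hs2 hd hw₁u hu₁
    rw [← rsum_rot n y' z' x' w₁, ← rsum_rot n y' z' x' u₁] at hc
    omega
  have hy'n : ¬ n ∣ y' := by
    intro hd
    have hs2 : n ∣ z' + x' + y' := by rwa [show z' + x' + y' = x' + y' + z' by ring]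
    have hc := rsum_const_of_dvd hn hs2 hd hw₁u hu₁
    rw [rsum_rot n x' y' z' w₁, rsum_rot n x' y' z' u₁] at hc
    omega
  refine ⟨hx'n, hy'n, hz'n, ?_⟩
  -- the type: B(t) = n ⟺ s(t) ∈ {1, 2} ⟺ t ∈ H_V
  intro t ht
  obtain ⟨s, hs1, hs4, hvt⟩ := hval t ht
  have hBt := (rsum_cases hn hsn' (not_dvd_unit_mul ht hz'n)).1
  have hu7 : Nat.Coprime (7 * t) n := Nat.Coprime.mul_left h7cop ht
  obtain ⟨s', hs1', hs4', hvu⟩ := hval (7 * t) hu7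
  have hstep := val_step7 n g y (7 * t) t s' s hn5 hg0 (Nat.ModEq.refl _) hvt hvu
  have hB7 := (rsum_cases hn hsn' (not_dvd_unit_mul hu7 hz'n)).1
  obtain ⟨t₁, ht₁⟩ := exists_t₁ 7 n t hp h7n hn
  have ht₁u := coprime_t₁ ht₁ ht
  have hB1 := (rsum_cases hn hsn' (not_dvd_unit_mul ht₁u hz'n)).1
  rw [inH_iff_rsum hn hsn' ht hz'n]
  show rsum n (x', y', z') t = n ↔ t * y % n + t * y % n < n
  rw [hvt]
  interval_cases s
  · -- s = 1: B(t₁) = B(t) + n ≤ 2n, so B(t) = n; and 2g < 5g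
    have h1 := (key t t₁ 1 ht ht₁ hvt).1 rfl
    constructor
    · intro; omega
    · intro; omega
  · -- s = 2: s(7t) = 4, B(7t) = B(t) + n, so B(t) = n; and 4g < 5g
    have h4 : s' = 4 := by omega
    rw [h4] at hvu
    have h2 := (key (7 * t) t 4 hu7 (Nat.ModEq.refl _) hvu).2 rfl
    constructor
    · intro; omega
    · intro; omega
  · -- s = 3: s(7t) = 1, B(t) = B(7t) + n = 2n; and 6g ≥ 5g
    have h1 : s' = 1 := by omega
    rw [h1] at hvu
    have h2 := (key (7 * t) t 1 hu7 (Nat.ModEq.refl _) hvu).1 rfl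
    constructor
    · intro h; omega
    · intro h; omega
  · -- s = 4: B(t) = B(t₁) + n = 2n; and 8g ≥ 5g
    have h1 := (key t t₁ 4 ht ht₁ hvt).2 rfl
    constructor
    · intro h; omega
    · intro h; omega


end HodgeFermat.KRFree.TheoremL
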